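import Summits.BirchSwinnertonDyer.BirchSwinnertonDyer.Theses.PrintX8VSC
import Summits.BirchSwinnertonDyer.BirchSwinnertonDyer.Theorems.ConjSpanGenAllLevels
import Literature.NumberTheory.Automorphic.CongruenceSubgroupPropertySL2AwayHolds
import HarnessLib

/-!
# Route `PrintX8VSC` (print-keyed repair twin of `PrintX8VS`; born 2026-08-28T22:36Z), item stmt-BirchSwinnertonDyer-23735
# `ConjSpanGenAll` — THEOREM B — PROVED (the route-independent kernel theorem of its `PrintX8VS` twin 21705, re-targeted)

Cell `bsd-ssimc`, width seat `cruxlead-stmt-BirchSwinnertonDyer-19875-w3` (gen 10) under the 19875 LEAD. The born support decl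
`PrintX8VSC.ConjSpanGenAll` unfolds to `∀ (N p : ℕ), p.Prime → ¬ p ∣ N → Rank1Residual.ConjSpanGen N p`, letter for letter the statement of
route `PrintX8VS`'s crux 21705 (CLOSED·proved by `PrintX8VSConjSpanGenAll.conjSpanGenAll_holds`, cell `bsd-print-x8` p3 g4) and of the
route-independent `Theorems.ConjSpanGenAllLevels.ConjSpanGenAll`. This file is the same kernel proof pointed at the new decl WITHOUT importing
the γ-keyed route file (theses-cone hygiene): THEOREM B = `ConjSpanGenAllLevels.conjSpanGenAll_of_vaserstein_away` (the orbit trick in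
`Γ₀(N; ℤ[1/p])`, bsd-f3-mu-an g5 / p4 g2) applied to Vaserstein's relative theorem over `ℤ[1/m]`, `SL2Rel.Away.relG_le_relE_span_natCast`
(ty2 g7, input-free). HONEST FRAMING: no new mathematics; unconditional; BSD / K′ / C′ / MC′ are not touched.

References: [Vaserstein1972SL2] Theorem (p. 313); [Manin1972] Prop. 1.4; [SerreSL2Congruence1970] §2.6 Thm. 2 (b); route file `Theses/PrintX8VSC.lean`
(rev 2, item 23735); tree `Theorems/PrintX8VSConjSpanGenAll.lean` (the twin's closer), `Theorems/ConjSpanGenAllLevels.lean`.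
-/

set_option autoImplicit false
-- justification: the mandated namespace `Summit.BirchSwinnertonDyer.BirchSwinnertonDyer.Theorems`
-- (single-conjunct summit, Sub = Summit) repeats a segment by design (D-0017).
set_option linter.dupNamespace false

namespace Summit.BirchSwinnertonDyer.BirchSwinnertonDyer.Theorems.PrintX8VSCGlue

open Literature Literature.NumberTheory.Automorphic
  Summit.BirchSwinnertonDyer.BirchSwinnertonDyer.Theorems
  Summit.BirchSwinnertonDyer.BirchSwinnertonDyer.Theses.PrintX8VSC

/-- **Item stmt-BirchSwinnertonDyer-23735 `PrintX8VSC.ConjSpanGenAll` — THEOREM B — holds, unconditionally**: for every `N` and every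
prime `p ∤ N`, `ConjSpanGen N p` (`Γ_H(N) ⊆ ⟨good, torsion, parabolic⟩ · [Γ₀(N), Γ₀(N)]`). Proof:
`ConjSpanGenAllLevels.conjSpanGenAll_of_vaserstein_away` applied to Vaserstein's relative theorem over `ℤ[1/m]`,
`SL2Rel.Away.relG_le_relE_span_natCast` — the twin 21705's proof token for token. [cite: Vaserstein1972SL2, Theorem (p. 313)]
[cite: Manin1972, Prop. 1.4] [cite: SerreSL2Congruence1970, §2.6 Thm. 2 (b)] -/
theorem conjSpanGenAll_holds : Theses.PrintX8VSC.ConjSpanGenAll :=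
  ConjSpanGenAllLevels.conjSpanGenAll_of_vaserstein_away SL2Rel.Away.relG_le_relE_span_natCast

end Summit.BirchSwinnertonDyer.BirchSwinnertonDyer.Theorems.PrintX8VSCGlue
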